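import Summits.CriticalPhenomena.CardyFormulaZ2.Theorems.CardyBoundaryCoulombGasHalfPlaneMarkDensityLawDensityIdentification
import Summits.CriticalPhenomena.CardyFormulaZ2.Theorems.CardyBoundaryCoulombGasHalfPlaneMarkDensityLawWindowLowerBound

/-!
# `HalfPlaneMarkDensityLaw` (crux stmt-CriticalPhenomena-5661), line `Sketch`, dense positivity:
# stub `stub_deriv4_pos_openDense_of` (P2') — `∂₄G > 0` on an open dense subset of `(c,∞)`

Pure glue.  `G` is a joint subsequential limit of the half-plane crossing probabilities
`P_n(a,b,c,y) = P_{1/2}[[⌊an⌋,⌊bn⌋]×{0} ↔ [⌊cn⌋,⌊yn⌋]×{0} in ℤ×ℕ]` along a strictly increasing `θ`.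
On the chamber `a < b < c`:

* `y ↦ G a b c y` is differentiable on `(c,∞)` (`Density.differentiableOn_jointLimit`) with a
  continuous derivative there (`Density.continuousOn_deriv_jointLimit`), and strictly increasing
  (`Window.stub_jointLimit_strictMono`);
* openness: `{x | c < x ∧ 0 < ∂₄G(a,b,c,x)} = (c,∞) ∩ (∂₄G(a,b,c,·))⁻¹' (0,∞)` is open by
  `ContinuousOn.isOpen_inter_preimage`;
* density: the real-analysis input P1 (a strictly increasing function differentiable on `(u,∞)` has
  positive derivative on a dense subset of `(u,∞)`) applied to `f := G a b c`, `u := c`.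
-/

noncomputable section

namespace Summit.CriticalPhenomena.CardyFormulaZ2.Cruxes.HalfPlaneMarkDensityLaw.SketchLine

open Literature.Probability.Percolation Literature.Probability.LatticeModels
open MeasureTheory Filter Set
open scoped Topology
open Summit.CriticalPhenomena.CardyFormulaZ2.Theorems.HalfPlaneMarkDensityLaw.Negative

namespace DensePos

/-- STUB P2' (glue): P1 gives P2 (`Density.differentiableOn_jointLimit`,
`Density.continuousOn_deriv_jointLimit`, `Window.stub_jointLimit_strictMono`): **`∂₄G > 0` on an open
dense subset of `(c,∞)`** for every joint subsequential limit, granted the real-analysis fact that a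
strictly increasing differentiable function has positive derivative on a dense set. [folklore] -/
theorem stub_deriv4_pos_openDense_of :
    (∀ (f : ℝ → ℝ) (u : ℝ), StrictMonoOn f (Ioi u) → DifferentiableOn ℝ f (Ioi u) →
      Ioi u ⊆ closure {x | u < x ∧ 0 < deriv f x}) →
    ∀ {θ : ℕ → ℕ} {G : ℝ → ℝ → ℝ → ℝ → ℝ},
      (∀ a b c y : ℝ, a < b → b < c → c < y →
        Tendsto (fun n ↦ μ.real (openCrossing halfPlane (arcA a b (θ n))
          (rowIcc ⌊c * (θ n : ℕ)⌋ ⌊y * (θ n : ℕ)⌋))) atTop (𝓝 (G a b c y))) →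
      StrictMono θ → ∀ {a b c : ℝ}, a < b → b < c →
        IsOpen {x | c < x ∧ 0 < deriv (G a b c) x} ∧ Ioi c ⊆ closure {x | c < x ∧ 0 < deriv (G a b c) x} := by
  intro hP1 θ G hG hθ a b c hab hbc
  -- regularity of the joint limit in the fourth mark: `C¹` and strictly increasing on `(c,∞)`
  have hcont : ContinuousOn (deriv (G a b c)) (Ioi c) :=
    Density.continuousOn_deriv_jointLimit hG hθ.tendsto_atTop hab hbc
  have hdiff : DifferentiableOn ℝ (G a b c) (Ioi c) :=
    Density.differentiableOn_jointLimit hG hθ.tendsto_atTop hab hbc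
  have hmono : StrictMonoOn (G a b c) (Ioi c) := fun x hx y _ hxy ↦
    Window.stub_jointLimit_strictMono hG hθ hab hbc hx hxy
  refine ⟨?_, hP1 (G a b c) c hmono hdiff⟩
  -- openness: the set is `(c,∞) ∩ (∂₄G)⁻¹' (0,∞)` with `∂₄G` continuous on the open set `(c,∞)`
  have hset : {x | c < x ∧ 0 < deriv (G a b c) x} = Ioi c ∩ deriv (G a b c) ⁻¹' Ioi 0 :=
    Set.ext fun _ ↦ Iff.rfl
  rw [hset]
  exact hcont.isOpen_inter_preimage isOpen_Ioi isOpen_Ioi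

end DensePos

end Summit.CriticalPhenomena.CardyFormulaZ2.Cruxes.HalfPlaneMarkDensityLaw.SketchLine
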